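import Mathlib
import HarnessLib

/-!
# Points with values in a square-zero thickening: convolution is ADDITION near the counit; coordinates of the points of a
# linearly-unobstructed nilpotent algebra

Topic `Literature/RingTheory/HopfAlgebra`, namespace `Literature.RingTheory.HopfAlgebra`.  THEOREMS ONLY; no definition, no named fact, no
instance, no notation, no `sorry`; Mathlib-only imports.

THE PRINT.  [Waterhouse1979] §12.2 (the Lie algebra of an affine group scheme `G = Spec E`: the points of `G` with values in `k[τ]`, `τ² = 0`,
reducing to the unit form the kernel of `G(k[τ]) → G(k)`, on which the group law is ADDITION of tangent vectors); [GortzWedhorn2023] Remark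
27.18 (3)–(4) («as `m ∘ (id, e) = id` we find `m_*(ξ, 0) = ξ`, similarly `m_*(0, ζ) = ζ`, hence `m_*(ξ, ζ) = ξ + ζ`»).  In RING form, for an
`A`-bialgebra `E` (Mathlib `Bialgebra A E`, points = algebra maps `E →ₐ[A] D` with Mathlib's CONVOLUTION product `WithConv (E →ₐ[A] D)`,
`(f * g) e = lift f g (comul e)`, unit `e ↦ algebraMap (counit e)`) and a commutative `A`-algebra `D` with an ideal `I`, `I · I = 0`:

* §1 **`convMul_apply_of_sub_mem_sq_zero`** — if `f` and `g` are `I`-CLOSE TO THE COUNIT (`f e − algebraMap (counit e) ∈ I`, same for `g`;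
  i.e. both reduce to the unit point modulo `I`) then `(f * g) e = f e + g e − algebraMap A D (counit e)` for every `e`.  Proof = the printed
  one: as linear maps `E ⊗ E → D`, `lift f g = lift f 1 + lift 1 g − lift 1 1` because `(f u − ε u)(g v − ε v) ∈ I · I = 0` on pure tensors, and
  `lift f 1 ∘ comul = f * 1 = f` etc. by the counit laws (Mathlib's `Monoid (WithConv (E →ₐ[A] D))`).  No commutativity, no antipode, no
  smoothness is used; only the two counit axioms.
* §2 COORDINATES.  For a commutative `A`-algebra `E` GENERATED by a family `x : σ → E` (`MvPolynomial.aeval x` surjective) whose polynomial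
  relations have NO CONSTANT AND NO LINEAR PART (`aeval x P = 0 ⇒ coeff 0 P = 0 ∧ coeff (single s 1) P = 0` — «linearly unobstructed»; e.g.
  the unit components `𝒪(G[p^m]⁰) = A[[x₁..x_g]] ⧸ K_m` of the layers of a Barsotti–Tate group over an Artinian local `A` FOR `m ≫ 0` ONLY:
  `K_m ⊆ 𝔪_R^{N+1} ⊆ (x)²` by Chevalley's lemma once `𝔪_A^N = 0`, ★ `AdicTopology/ChevalleyTowerLift`; at a FIXED small layer it fails —
  [Tate1967] §2.2: `K_ν` is generated by the `[p^ν]`-series `p^ν X_i + (deg ≥ 2)`, so for `𝒪(μ_p)` over `ℤ⧸p²` the `(ε)`-valued points are only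
  `{j : p j = 0}`): **`exists_algHom_apply_eq_of_sq_zero`**
  ∕ **`algHom_ext_of_apply_eq`** — for every `j : σ → I` there is EXACTLY ONE `ψ : E →ₐ[A] D` with `ψ (x s) = j s` (the points reducing into `I`
  are the `σ`-tuples in `I`); `sub_mem_of_apply_sub_mem` — points with `I`-close coordinates are `I`-close; and, when `E` is moreover a
  bialgebra with `counit (x s) = 0`, **`convMul_apply_generator`** — the coordinates of `f * g` are `f (x s) + g (x s)`: the points with
  coordinates in `I` form a group isomorphic to `(I^σ, +)`.
* §3 FEEDERS for §2's hypothesis from power series: `MvPolynomial.mem_span_X_pow_two_of_coeff_eq_zero` (vanishing constant + linear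
  coefficients ⇒ `P ∈ (X)²`) and `MvPowerSeries.coeff_eq_zero_of_mem_span_X_pow_two` (membership in `(X)² ⊆ A[[x]]` ⇒ vanishing constant + linear
  coefficients), so that «`ker φ ⊆ (X)²` in `A[[x]]`» (Chevalley, ★ `AdicTopology/ChevalleyCofinality`) feeds §2 through `MvPolynomial.coeff_coe`.

Written for cell `hodgecm-mathlib`, P6b σ2, E2a road KF1♭ organ T3 (S6 «unit-lifts over a square-zero thickening are the module `(J′D)^g`,
additively»; consumer: the Amitsur-cocycle descent S8 over ★ `Flat/AmitsurDegreeOne`, and the scheme side through ★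
`AffineGroupScheme.ptMulEquiv : (Spec R′ ⟶ G) ≃* WithConv (Γ(G) →ₐ[R] R′)`); HC_CM is proved only modulo the 7 printed citations until rung 0
closes; nothing here is about HC.

## References
* [Waterhouse1979] W. C. Waterhouse, *Introduction to Affine Group Schemes*, GTM 66 (1979), §12.2.
* [GortzWedhorn2023] U. Görtz, T. Wedhorn, *Algebraic Geometry II* (2023), Remark 27.18 (3)–(4).
* [Tate1967] J. T. Tate, *p-divisible groups*, Proc. Conf. Local Fields (Driebergen 1966), Springer (1967), §2.2 (points of the unit components
  `A[[x]] ⧸ K` of a `p`-divisible group).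
* [BourbakiAlgebraII2003] N. Bourbaki, *Algebra II*, Ch. IV §4 no. 2 (order of a formal power series; the ideals of series of order `≥ n`).
-/

universe u v w uσ

open TensorProduct WithConv

namespace Literature.RingTheory.HopfAlgebra

/-! ## §1 Convolution of points that reduce to the unit modulo a square-zero ideal is addition -/

section Convolution

variable {A : Type u} [CommRing A] {E : Type v} [CommRing E] [Bialgebra A E]
variable {D : Type w} [CommRing D] [Algebra A D]

/-- The square-zero identity behind additivity: if `a − a₀ ∈ I`, `b − b₀ ∈ I` and `I · I = 0` then
`a b = a b₀ + a₀ b − a₀ b₀`. [folklore] -/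
private theorem mul_eq_of_sub_mem_sq_zero {I : Ideal D} (hI : I * I = ⊥) {a a₀ b b₀ : D} (ha : a - a₀ ∈ I) (hb : b - b₀ ∈ I) :
    a * b = a * b₀ + a₀ * b - a₀ * b₀ := by
  have h : (a - a₀) * (b - b₀) = 0 := by
    have hmem : (a - a₀) * (b - b₀) ∈ I * I := Ideal.mul_mem_mul ha hb
    rw [hI] at hmem
    exact (Submodule.mem_bot D).mp hmem
  have h' : a * b - a * b₀ - a₀ * b + a₀ * b₀ = 0 := by rw [← h]; ring
  linear_combination h'

/-- For points `f, g : E →ₐ[A] D` that are `I`-close to the counit point (`I · I = 0`), the bilinear map `u ⊗ v ↦ f u · g v` equals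
`lift f ε̂ + lift ε̂ g − lift ε̂ ε̂` (`ε̂ = algebraMap ∘ counit`, the unit of Mathlib's convolution monoid), as linear maps `E ⊗ E → D`.
[cite: GortzWedhorn2023, Remark 27.18 (3)–(4)] -/
theorem lift_toLinearMap_eq_of_sub_mem_sq_zero (I : Ideal D) (hI : I * I = ⊥) (f g : E →ₐ[A] D)
    (hf : ∀ e, f e - algebraMap A D (Coalgebra.counit e) ∈ I) (hg : ∀ e, g e - algebraMap A D (Coalgebra.counit e) ∈ I) :
    (Algebra.TensorProduct.lift f g (fun _ _ => Commute.all _ _)).toLinearMap =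
      (Algebra.TensorProduct.lift f ((Algebra.ofId A D).comp (Bialgebra.counitAlgHom A E)) (fun _ _ => Commute.all _ _)).toLinearMap +
        (Algebra.TensorProduct.lift ((Algebra.ofId A D).comp (Bialgebra.counitAlgHom A E)) g (fun _ _ => Commute.all _ _)).toLinearMap -
        (Algebra.TensorProduct.lift ((Algebra.ofId A D).comp (Bialgebra.counitAlgHom A E))
          ((Algebra.ofId A D).comp (Bialgebra.counitAlgHom A E)) (fun _ _ => Commute.all _ _)).toLinearMap := by
  apply TensorProduct.ext'
  intro u v
  simp only [LinearMap.add_apply, LinearMap.sub_apply, AlgHom.toLinearMap_apply, Algebra.TensorProduct.lift_tmul,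
    AlgHom.coe_comp, Function.comp_apply, Bialgebra.counitAlgHom_apply, Algebra.ofId_apply]
  exact mul_eq_of_sub_mem_sq_zero hI (hf u) (hg v)

/-- **CONVOLUTION NEAR THE COUNIT IS ADDITION** ([Waterhouse1979] §12.2; [GortzWedhorn2023] Rem. 27.18 (3)–(4), ring form): for an
`A`-bialgebra `E`, a commutative `A`-algebra `D` with an ideal `I`, `I · I = 0`, and two points `f g : E →ₐ[A] D` which REDUCE TO THE UNIT
MODULO `I` (`f e − algebraMap (counit e) ∈ I`, `g e − algebraMap (counit e) ∈ I`), Mathlib's convolution product satisfies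
`(f * g) e = f e + g e − algebraMap A D (counit e)`.  Only the counit laws are used (through `f * 1 = f`, `1 * g = g` in Mathlib's
`Monoid (WithConv (E →ₐ[A] D))`). [cite: Waterhouse1979, §12.2] [cite: GortzWedhorn2023, Remark 27.18 (3)–(4)] -/
theorem convMul_apply_of_sub_mem_sq_zero (I : Ideal D) (hI : I * I = ⊥) (f g : WithConv (E →ₐ[A] D))
    (hf : ∀ e, f.ofConv e - algebraMap A D (Coalgebra.counit e) ∈ I) (hg : ∀ e, g.ofConv e - algebraMap A D (Coalgebra.counit e) ∈ I)
    (e : E) :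
    (f * g).ofConv e = f.ofConv e + g.ofConv e - algebraMap A D (Coalgebra.counit e) := by
  have h1 : (f * 1).ofConv e = f.ofConv e := by rw [mul_one]
  have h2 : (1 * g).ofConv e = g.ofConv e := by rw [one_mul]
  have h3 : ((1 : WithConv (E →ₐ[A] D)) * 1).ofConv e = algebraMap A D (Coalgebra.counit e) := by
    rw [mul_one]; rfl
  rw [AlgHom.convMul_apply] at h1 h2 h3 ⊢
  have key := congrArg (fun L : E ⊗[A] E →ₗ[A] D => L (Coalgebra.comul e))
    (lift_toLinearMap_eq_of_sub_mem_sq_zero I hI f.ofConv g.ofConv hf hg)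
  simp only [LinearMap.add_apply, LinearMap.sub_apply, AlgHom.toLinearMap_apply] at key
  rw [key]
  change _ = _ at h1
  erw [h1, h2, h3]

end Convolution

/-! ## §3 (feeders, stated first) Constant and linear coefficients versus the ideal `(X)²` -/

section Coefficients

variable {A : Type u} [CommRing A] {σ : Type uσ}

/-- A polynomial with vanishing constant and linear coefficients lies in `(X)² = (span {X_s})²`: every monomial in its support has total
degree `≥ 2`, hence is `X_s · X_t · (…)` (the ideal of polynomials of ORDER `≥ 2`).  Deliberately declared in Mathlib's `MvPolynomial`
namespace (dot-free statement about Mathlib's `MvPolynomial`, CONVENTIONS §2). [cite: BourbakiAlgebraII2003, Ch. IV §4 no. 2] -/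
theorem _root_.MvPolynomial.mem_span_X_pow_two_of_coeff_eq_zero (P : MvPolynomial σ A) (h0 : MvPolynomial.coeff 0 P = 0)
    (h1 : ∀ s, MvPolynomial.coeff (Finsupp.single s 1) P = 0) :
    P ∈ (Ideal.span (Set.range (MvPolynomial.X : σ → MvPolynomial σ A))) ^ 2 := by
  classical
  set J : Ideal (MvPolynomial σ A) := Ideal.span (Set.range (MvPolynomial.X : σ → MvPolynomial σ A)) with hJ
  have hX : ∀ s, (MvPolynomial.X s : MvPolynomial σ A) ∈ J := fun s => Ideal.subset_span ⟨s, rfl⟩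
  rw [MvPolynomial.as_sum P]
  refine Ideal.sum_mem _ fun m hm => ?_
  have hcm : MvPolynomial.coeff m P ≠ 0 := MvPolynomial.mem_support_iff.mp hm
  have hm0 : m ≠ 0 := fun h => hcm (h ▸ h0)
  -- pick `s` with `m s ≥ 1`
  obtain ⟨s, hs⟩ : ∃ s, m s ≠ 0 := by
    by_contra h
    push Not at h
    exact hm0 (Finsupp.ext h)
  by_cases hms : 2 ≤ m s
  · -- `m = single s 2 + m'`
    obtain ⟨m', rfl⟩ : ∃ m', m = Finsupp.single s 2 + m' :=
      ⟨m - Finsupp.single s 2, by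
        ext t
        simp only [Finsupp.coe_add, Finsupp.coe_tsub, Pi.add_apply, Pi.sub_apply, Finsupp.single_apply]
        split_ifs with h
        · subst h; omega
        · omega⟩
    rw [MvPolynomial.monomial_eq, Finsupp.prod_add_index' (by simp) (by simp [pow_add]), Finsupp.prod_single_index (by simp)]
    have : (MvPolynomial.X s : MvPolynomial σ A) ^ 2 ∈ J ^ 2 := Ideal.pow_mem_pow (hX s) 2
    exact Ideal.mul_mem_left _ _ (Ideal.mul_mem_right _ _ this)
  · have hms1 : m s = 1 := by omega
    -- `m ≠ single s 1`, so there is `t ≠ s` with `m t ≠ 0`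
    obtain ⟨t, hts, ht⟩ : ∃ t, t ≠ s ∧ m t ≠ 0 := by
      by_contra h
      push Not at h
      apply hcm
      have : m = Finsupp.single s 1 := by
        ext t
        by_cases hts : t = s
        · subst hts; simp [hms1]
        · rw [Finsupp.single_eq_of_ne hts]; exact h t hts
      rw [this]; exact h1 s
    obtain ⟨m', rfl⟩ : ∃ m', m = Finsupp.single s 1 + Finsupp.single t 1 + m' :=
      ⟨m - Finsupp.single s 1 - Finsupp.single t 1, by
        ext r
        simp only [Finsupp.coe_add, Finsupp.coe_tsub, Pi.add_apply, Pi.sub_apply, Finsupp.single_apply]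
        by_cases hrs : s = r
        · subst hrs; simp [hts, hms1]
        · by_cases hrt : t = r
          · subst hrt; simp [hrs]; omega
          · simp [hrs, hrt]⟩
    rw [MvPolynomial.monomial_eq, Finsupp.prod_add_index' (by simp) (by simp [pow_add]),
      Finsupp.prod_add_index' (by simp) (by simp [pow_add]), Finsupp.prod_single_index (by simp),
      Finsupp.prod_single_index (by simp), pow_one, pow_one]
    have : (MvPolynomial.X s : MvPolynomial σ A) * MvPolynomial.X t ∈ J ^ 2 := by
      rw [pow_two]; exact Ideal.mul_mem_mul (hX s) (hX t)
    exact Ideal.mul_mem_left _ _ (Ideal.mul_mem_right _ _ this)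

/-- An element of the ideal `(X) = span {X_s}` of `A[[x]]` has zero constant coefficient (it has ORDER `≥ 1`).  Deliberately declared in
Mathlib's `MvPowerSeries` namespace (statement about Mathlib's `MvPowerSeries`, CONVENTIONS §2). [cite: BourbakiAlgebraII2003, Ch. IV §4 no. 2] -/
theorem _root_.MvPowerSeries.constantCoeff_eq_zero_of_mem_span_X {f : MvPowerSeries σ A}
    (hf : f ∈ Ideal.span (Set.range (MvPowerSeries.X : σ → MvPowerSeries σ A))) : MvPowerSeries.constantCoeff f = 0 := by
  induction hf using Submodule.span_induction with
  | mem g hg => obtain ⟨s, rfl⟩ := hg; exact MvPowerSeries.constantCoeff_X s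
  | zero => exact map_zero _
  | add g g' _ _ hg hg' => rw [map_add, hg, hg', add_zero]
  | smul r g _ hg => rw [smul_eq_mul, map_mul, hg, mul_zero]

/-- **Membership in `(X)² ⊆ A[[x]]` kills the constant and the linear coefficients** — the form in which «`ker φ ⊆ (X)²`» (Chevalley's lemma
applied to a tower of unit components, [Tate1967] §2.2) is consumed by §2 (through `MvPolynomial.coeff_coe`); elements of `(X)²` have ORDER `≥ 2`.  Deliberately declared in Mathlib's `MvPowerSeries`
namespace (statement about Mathlib's `MvPowerSeries`, CONVENTIONS §2). [cite: BourbakiAlgebraII2003, Ch. IV §4 no. 2] -/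
theorem _root_.MvPowerSeries.coeff_eq_zero_of_mem_span_X_pow_two {f : MvPowerSeries σ A}
    (hf : f ∈ (Ideal.span (Set.range (MvPowerSeries.X : σ → MvPowerSeries σ A))) ^ 2) :
    MvPowerSeries.constantCoeff f = 0 ∧ ∀ s, MvPowerSeries.coeff (Finsupp.single s 1) f = 0 := by
  classical
  rw [pow_two] at hf
  refine Submodule.mul_induction_on hf (fun g hg h hh => ?_) (fun g h hg hh => ?_)
  · have hg0 := MvPowerSeries.constantCoeff_eq_zero_of_mem_span_X hg
    have hh0 := MvPowerSeries.constantCoeff_eq_zero_of_mem_span_X hh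
    refine ⟨by rw [map_mul, hg0, zero_mul], fun s => ?_⟩
    rw [MvPowerSeries.coeff_mul, Finsupp.antidiagonal_single, Finset.sum_map, Finset.Nat.antidiagonal_succ, Finset.sum_cons,
      Finset.Nat.antidiagonal_zero, Finset.map_singleton, Finset.sum_singleton]
    simp only [Function.Embedding.coeFn_mk, Function.Embedding.refl_apply, Finsupp.single_zero, Prod.map_apply,
      Nat.succ_eq_add_one, zero_add, Function.Embedding.coe_prodMap, MvPowerSeries.coeff_zero_eq_constantCoeff, hg0, hh0,
      zero_mul, mul_zero, add_zero]
  · exact ⟨by rw [map_add, hg.1, hh.1, add_zero], fun s => by rw [map_add, hg.2 s, hh.2 s, add_zero]⟩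

end Coefficients

/-! ## §2 Coordinates of the `I`-valued points of a linearly-unobstructed nilpotent algebra -/

section Coordinates

variable {A : Type u} [CommRing A] {σ : Type uσ} {E : Type v} [CommRing E] [Algebra A E] (x : σ → E)
variable {D : Type w} [CommRing D] [Algebra A D]

/-- Points are determined by their coordinates: if `E` is generated by the `x_s` (`aeval x` surjective), two algebra maps agreeing on the
`x_s` are equal. [cite: Tate1967, §2.2] -/
theorem algHom_ext_of_apply_eq (hgen : Function.Surjective (MvPolynomial.aeval x : MvPolynomial σ A →ₐ[A] E))
    {ψ ψ' : E →ₐ[A] D} (h : ∀ s, ψ (x s) = ψ' (x s)) : ψ = ψ' := by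
  apply AlgHom.ext
  intro e
  obtain ⟨P, rfl⟩ := hgen e
  rw [← AlgHom.comp_apply, ← AlgHom.comp_apply, MvPolynomial.comp_aeval, MvPolynomial.comp_aeval]
  exact congrFun (congrArg (fun j => ⇑(MvPolynomial.aeval (R := A) j)) (funext h)) P

/-- Points with `I`-close coordinates are `I`-close everywhere: if `ψ (x s) − ψ' (x s) ∈ I` for all generators then `ψ e − ψ' e ∈ I` for all
`e` (compare the two maps in `D ⧸ I`). [cite: Tate1967, §2.2] -/
theorem sub_mem_of_apply_sub_mem (hgen : Function.Surjective (MvPolynomial.aeval x : MvPolynomial σ A →ₐ[A] E))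
    (I : Ideal D) {ψ ψ' : E →ₐ[A] D} (h : ∀ s, ψ (x s) - ψ' (x s) ∈ I) (e : E) : ψ e - ψ' e ∈ I := by
  rw [← Ideal.Quotient.eq, ← Ideal.Quotient.mkₐ_eq_mk A, ← AlgHom.comp_apply, ← AlgHom.comp_apply]
  congr 1
  exact algHom_ext_of_apply_eq x hgen fun s => by
    rw [AlgHom.comp_apply, AlgHom.comp_apply, Ideal.Quotient.mkₐ_eq_mk, Ideal.Quotient.eq]; exact h s

/-- **EXISTENCE OF THE POINT WITH PRESCRIBED COORDINATES IN A SQUARE-ZERO IDEAL.**  Let `E` be generated by `x : σ → E` with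
LINEARLY-UNOBSTRUCTED relations (`aeval x P = 0 ⇒` the constant and the linear coefficients of `P` vanish), `D` a commutative `A`-algebra and
`I` an ideal with `I · I = 0`.  Then every `j : σ → I` is the coordinate vector of a point: `∃ ψ : E →ₐ[A] D, ψ (x s) = j s` (unique by
`algHom_ext_of_apply_eq`).  Proof: `aeval j : A[X_s] → D` kills `(X)²` (its image is `(j)² ⊆ I · I = 0`), hence (§3) every relation of the
`x_s`, so it factors through `aeval x : A[X_s] ↠ E`.  ([Tate1967] §2.2: for the unit components `A[[x]] ⧸ K_m` of a `p`-divisible group over an Artinian local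
base the hypothesis holds for `m ≫ 0` — `K_m ⊆ 𝔪_R^{N+1} ⊆ (x)²` by Chevalley's lemma — and then their points in a square-zero thickening of the
unit are all `g`-tuples; NOT at a fixed small layer, where `K_ν ∋ p^ν X_i + ⋯`.) [cite: Tate1967, §2.2] -/
theorem exists_algHom_apply_eq_of_sq_zero (hgen : Function.Surjective (MvPolynomial.aeval x : MvPolynomial σ A →ₐ[A] E))
    (hlin : ∀ P : MvPolynomial σ A, MvPolynomial.aeval x P = 0 →
      MvPolynomial.coeff 0 P = 0 ∧ ∀ s, MvPolynomial.coeff (Finsupp.single s 1) P = 0)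
    (I : Ideal D) (hI : I * I = ⊥) (j : σ → D) (hj : ∀ s, j s ∈ I) :
    ∃ ψ : E →ₐ[A] D, ∀ s, ψ (x s) = j s := by
  classical
  -- `aeval j` kills the kernel of `aeval x`
  have hker : RingHom.ker (MvPolynomial.aeval x : MvPolynomial σ A →ₐ[A] E).toRingHom ≤
      RingHom.ker (MvPolynomial.aeval j : MvPolynomial σ A →ₐ[A] D).toRingHom := by
    intro P hP
    rw [RingHom.mem_ker] at hP ⊢
    change MvPolynomial.aeval x P = 0 at hP
    change MvPolynomial.aeval j P = 0
    obtain ⟨h0, h1⟩ := hlin P hP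
    have hmem := MvPolynomial.mem_span_X_pow_two_of_coeff_eq_zero P h0 h1
    have hmap : Ideal.map (MvPolynomial.aeval j : MvPolynomial σ A →ₐ[A] D)
        ((Ideal.span (Set.range (MvPolynomial.X : σ → MvPolynomial σ A))) ^ 2) ≤ I * I := by
      rw [Ideal.map_pow, Ideal.map_span, pow_two]
      refine Ideal.mul_mono ?_ ?_ <;>
      · refine Ideal.span_le.mpr ?_
        rintro _ ⟨_, ⟨s, rfl⟩, rfl⟩
        simpa using hj s
    have : MvPolynomial.aeval j P ∈ I * I := hmap (Ideal.mem_map_of_mem _ hmem)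
    rw [hI] at this
    exact (Submodule.mem_bot D).mp this
  let ψ₀ : E →+* D := (MvPolynomial.aeval x : MvPolynomial σ A →ₐ[A] E).toRingHom.liftOfSurjective hgen
    ⟨(MvPolynomial.aeval j : MvPolynomial σ A →ₐ[A] D).toRingHom, hker⟩
  have hψ₀ : ∀ P, ψ₀ (MvPolynomial.aeval x P) = MvPolynomial.aeval j P := fun P =>
    RingHom.liftOfRightInverse_comp_apply _ _ _ _ P
  refine ⟨{ toRingHom := ψ₀, commutes' := fun a => ?_ }, fun s => ?_⟩
  · change ψ₀ (algebraMap A E a) = algebraMap A D a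
    rw [← MvPolynomial.aeval_C (f := x) a, hψ₀, MvPolynomial.aeval_C]
  · change ψ₀ (x s) = j s
    rw [← MvPolynomial.aeval_X (R := A) x s, hψ₀, MvPolynomial.aeval_X]

/-- Uniqueness packaged with existence: `∃! ψ : E →ₐ[A] D, ∀ s, ψ (x s) = j s` — the points of `Spec E` with values in `D` whose coordinates
lie in the square-zero ideal `I` are in bijection with `I^σ`. [cite: Tate1967, §2.2] -/
theorem existsUnique_algHom_apply_eq_of_sq_zero (hgen : Function.Surjective (MvPolynomial.aeval x : MvPolynomial σ A →ₐ[A] E))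
    (hlin : ∀ P : MvPolynomial σ A, MvPolynomial.aeval x P = 0 →
      MvPolynomial.coeff 0 P = 0 ∧ ∀ s, MvPolynomial.coeff (Finsupp.single s 1) P = 0)
    (I : Ideal D) (hI : I * I = ⊥) (j : σ → D) (hj : ∀ s, j s ∈ I) :
    ∃! ψ : E →ₐ[A] D, ∀ s, ψ (x s) = j s := by
  obtain ⟨ψ, hψ⟩ := exists_algHom_apply_eq_of_sq_zero x hgen hlin I hI j hj
  exact ⟨ψ, hψ, fun ψ' hψ' => algHom_ext_of_apply_eq x hgen fun s => by rw [hψ', hψ]⟩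

end Coordinates

/-! ## §2′ Coordinates add under convolution -/

section CoordinatesConvolution

variable {A : Type u} [CommRing A] {σ : Type uσ} {E : Type v} [CommRing E] [Bialgebra A E] (x : σ → E)
variable {D : Type w} [CommRing D] [Algebra A D]

/-- A point whose coordinates lie in `I` reduces to the unit modulo `I`, provided the generators are killed by the counit
(`counit (x s) = 0`): `ψ e − algebraMap (counit e) ∈ I` for all `e`. [cite: Waterhouse1979, §12.2] -/
theorem sub_algebraMap_counit_mem (hgen : Function.Surjective (MvPolynomial.aeval x : MvPolynomial σ A →ₐ[A] E))
    (hε : ∀ s, Coalgebra.counit (R := A) (x s) = 0) (I : Ideal D) (ψ : E →ₐ[A] D) (hψ : ∀ s, ψ (x s) ∈ I) (e : E) :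
    ψ e - algebraMap A D (Coalgebra.counit e) ∈ I := by
  have h := sub_mem_of_apply_sub_mem x hgen I (ψ := ψ) (ψ' := (Algebra.ofId A D).comp (Bialgebra.counitAlgHom A E))
    (fun s => by
      rw [AlgHom.comp_apply, Bialgebra.counitAlgHom_apply, hε s, map_zero, sub_zero]; exact hψ s) e
  simpa using h

/-- **COORDINATES ADD UNDER CONVOLUTION** ([Waterhouse1979] §12.2; [Tate1967] §2.2): for an `A`-bialgebra `E` generated by `x : σ → E` with
`counit (x s) = 0`, a commutative `A`-algebra `D` with `I · I = 0`, and points `f, g` with coordinates in `I`, the convolution product has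
coordinates `(f * g) (x s) = f (x s) + g (x s)` — the points with coordinates in `I` form a group isomorphic to `(I^σ, +)` (with §2: every
`σ`-tuple in `I` occurs exactly once when the relations of the `x_s` are linearly unobstructed). [cite: Waterhouse1979, §12.2]
[cite: Tate1967, §2.2] -/
theorem convMul_apply_generator (hgen : Function.Surjective (MvPolynomial.aeval x : MvPolynomial σ A →ₐ[A] E))
    (hε : ∀ s, Coalgebra.counit (R := A) (x s) = 0) (I : Ideal D) (hI : I * I = ⊥) (f g : WithConv (E →ₐ[A] D))
    (hf : ∀ s, f.ofConv (x s) ∈ I) (hg : ∀ s, g.ofConv (x s) ∈ I) (s : σ) :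
    (f * g).ofConv (x s) = f.ofConv (x s) + g.ofConv (x s) := by
  rw [convMul_apply_of_sub_mem_sq_zero I hI f g (sub_algebraMap_counit_mem x hgen hε I f.ofConv hf)
    (sub_algebraMap_counit_mem x hgen hε I g.ofConv hg), hε s, map_zero, sub_zero]

/-- Inverse points have opposite coordinates: if `f * g = 1` then `f (x s) + g (x s) = 0`. [cite: Waterhouse1979, §12.2] -/
theorem apply_generator_add_eq_zero_of_convMul_eq_one
    (hgen : Function.Surjective (MvPolynomial.aeval x : MvPolynomial σ A →ₐ[A] E))
    (hε : ∀ s, Coalgebra.counit (R := A) (x s) = 0) (I : Ideal D) (hI : I * I = ⊥) (f g : WithConv (E →ₐ[A] D))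
    (hf : ∀ s, f.ofConv (x s) ∈ I) (hg : ∀ s, g.ofConv (x s) ∈ I) (hfg : f * g = 1) (s : σ) :
    f.ofConv (x s) + g.ofConv (x s) = 0 := by
  rw [← convMul_apply_generator x hgen hε I hI f g hf hg s, hfg]
  change algebraMap A D (Coalgebra.counit (x s)) = 0
  rw [hε s, map_zero]

end CoordinatesConvolution

end Literature.RingTheory.HopfAlgebra
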